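import Literature.MathematicalPhysics.QuantumLattice.HubbardTTPrimeCapCutDualRows
import Literature.MathematicalPhysics.QuantumLattice.HubbardNNNHoppingEnergyDensityParticleHole
import HarnessLib

/-!
# The APEX row: eliminating the on-site coordinate from the two cross variational inequalities
# of a pair of `t–t'–U` ground states at different `(t', U)` — one-body energies at the apex hopping
# are monotone along every ray of the `(t', U)` half-plane

Family `hubbard` (topic `MathematicalPhysics/QuantumLattice`; companion of `HubbardTTPrimeCapCutDualRows` §4/§6/§7).
Written for the MO-S1/S2 seam of the Hubbard material oracle (cell `pub/hubbard-downfold`, row "robustness lemmas: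
monotonicity / Lipschitz of certified words in `(t', U, μ)` so a parameter BOX maps to ONE certified word", seat
`hubbard-downfold-unc-2`), specifically for the `U`-INTERIOR of a `(t', U)` box of the `t–t'` f-sum stiffness word, which the
vertical rule "T-mono" (`IsTorusLimitOf.docc_le_and_oneBody_le_of_groundStates`: the full one-body energy `e_{Φ(t,t',0)}` is
non-decreasing in `U` at fixed `t'`) does not move at `t' ≠ 0` (the f-sum functional weighs the diagonal bonds with RELATIVE weight
`2t'`, not `t'`). Everything is PROVED; no definition, no named fact, no number.

Coordinates as in `HubbardTTPrimeCapCutDualRows`: `K₁(ω) = e_{Φ(1,0,0)}(ω)`, `K₂(ω) = e_{Φ(0,1,0)}(ω)`, `D(ω) = e_{Φ(0,0,1)}(ω)`,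
`e_{Φ(t,t',U)}(ω) = t·K₁ + t'·K₂ + U·D` (`meanEnergy_hubbardTTPrime_eq_coords`).

§1 (every pair of states). Let `ωA`, `ωP` satisfy the two CROSS inequalities at the couplings `A = (t, t'_A, U_A)` and
`P = (t, t'_P, U_P)` (`U_A, U_P ≥ 0`): `e_{Φ(P)}(ωP) ≤ e_{Φ(P)}(ωA)` and `e_{Φ(A)}(ωA) ≤ e_{Φ(A)}(ωP)` (two torus-limit ground states of
the same density are such a pair). Multiplying the first by `U_A`, the second by `U_P` and adding CANCELS the on-site coordinate:

  `(U_P − U_A)·t·K₁(ωA) + (U_P t'_A − U_A t'_P)·K₂(ωA) ≤ (U_P − U_A)·t·K₁(ωP) + (U_P t'_A − U_A t'_P)·K₂(ωP)`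
  (`apex_le_of_cross_variational`),

i.e. for `U_A < U_P` the ONE-BODY energy at the hopping `κ = (U_P t'_A − U_A t'_P)/(U_P − U_A)` is non-decreasing from `A` to `P`
(`meanEnergy_apexHopping_le_of_cross_variational`). Geometrically `κ` is the `t'`-coordinate of the point `X = (κ, 0)` where the
line through `A = (t'_A, U_A)` and `P = (t'_P, U_P)` meets the `U = 0` axis (the APEX of the ray): the one-body energy of the
apex Hamiltonian `Φ(t, κ, 0)` is non-decreasing along every ray leaving the apex — the vertical ray (`t'_A = t'_P`, `κ = t'`) is
T-mono (§4 of the companion), the rays through the origin are the radial rule of its §7; no derivative, no uniqueness, no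
concavity lemma is used, only the two variational inequalities (Koma–Tasaki §1, Griffiths 1966 §II).

§2 (the doubled-hopping case). When `A` lies on the segment from the apex `X_P = (2t'_P, 0)` to `P`, i.e.
`U_P·t'_A = (2U_P − U_A)·t'_P`, the apex hopping is `κ = 2t'_P` and §1 reads `e_{Φ(t,2t'_P,0)}(ωA) ≤ e_{Φ(t,2t'_P,0)}(ωP)`
(`meanEnergy_twice_tPrime_le_of_cross_variational_of_apex`). This is the form the stiffness seat consumes: by the `D₄`-orbit
dictionary of the `t–t'` f-sum functional (Summits `Observables/StiffnessTLKineticTTOrbitDictionary`: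
`|D₄|⁻¹Σ_γ Re ω_γ(X₀(t')) = −¼ e_{Φ(1,2t',0)}(ω)`) the f-sum stiffness ceiling at `P` is EXACTLY `−¼ e_{Φ(1,2t'_P,0)}(ωP)`, so it is
bounded by `−¼ e_{Φ(1,2t'_P,0)}(ωA)` for every source `A` between the apex and `P` — `U_A = 0` (the apex itself, a free Fermi sea at
doubled `t'`) is the kinematic leaf, `U_A → U_P` the point itself.

§3 (torus-limit ground states). The cross inequalities for two torus limits of unit `(rectN n, S^z = 0)`-sector ground states of
the same density (`IsTorusLimitOf.cross_variational_of_groundStates`, the two lines every §4/§6/§7 proof of the companion repeats),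
and the ground-state forms of §1/§2 (`IsTorusLimitOf.apex_le_of_groundStates`, `IsTorusLimitOf.meanEnergy_apexHopping_le_of_groundStates`,
`IsTorusLimitOf.meanEnergy_twice_tPrime_le_of_groundStates_apex`).

§4 (half filling). At `n = 1` the energy density is EVEN in `t'` (`energyDensityTT'_particleHole_one`), so the variational
inequality at the mirror coupling `(t, −t', U)` gives `t'·K₂(ω) ≤ 0` for every torus-limit ground state at `(t, t', U, 1)`
(`IsTorusLimitOf.tPrime_mul_diagHopEnergy_nonpos_of_groundState_halfFilling`): the diagonal-hopping energy has the sign of `−t'`.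
Hence the one-body energy `e_{Φ(t,κ,0)}(ω)` is monotone in the hopping `κ` in the direction of `t'`
(`IsTorusLimitOf.meanEnergy_oneBody_anti_hopping_of_groundState_halfFilling`: `κ' − κ = c·t'`, `c ≥ 0` ⇒
`e_{Φ(t,κ',0)}(ω) ≤ e_{Φ(t,κ,0)}(ω)`), and on the apex segment the SOURCE's own doubled hopping `2t'_A` compares with the target's:
`e_{Φ(t,2t'_A,0)}(ωA) ≤ e_{Φ(t,2t'_P,0)}(ωP)` (`IsTorusLimitOf.meanEnergy_twice_tPrime_source_le_of_groundStates_apex_halfFilling`) —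
at half filling the f-sum stiffness word at `P` is at most the f-sum stiffness word at `A`, for EITHER sign of `t'`.

What is NOT here: nothing moves toward SMALLER `U` (ceilings on `−e_{Φ(t,κ,0)}` flow away from the apex only); nothing at fixed `U`
between two `t'` (there the apex row degenerates to the `t'`-antitonicity of `K₂`, §6 of the companion); no statement about the odd-moment
(`λ ≠ 0`) words; no `T > 0` statement; no number.

## Mathlib / tree search

REUSED: `InfVolFermionState.meanEnergy_hubbardTTPrime_eq_coords/_affine/_smul`,
`IsTorusLimitOf.meanEnergy_hubbardTTPrime_eq_energyDensityTT'`, `IsTorusLimitOf.energyDensityTT'_le_meanEnergy_hubbardTTPrime`,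
`energyDensityTT'_particleHole_one`, `mem_szSector_iff`. `lean search 'apex|cross_variational|radial_mono' --decl`: only the
companion's §4/§6/§7 rows (vertical, fixed-direction and radial-through-the-origin cases); no `D`-eliminated two-point row.

## References

* T. Koma, H. Tasaki, J. Stat. Phys. 76 (1994) 745, §1 (energy slopes in a coupling bound the conjugate observable of every
  ground state; the variational inequalities used here). [cite: KomaTasaki1994, §1]
* R. B. Griffiths, Phys. Rev. 152 (1966) 240, §II (monotonicity of conjugate observables of energy minimisers). [cite: Griffiths1966, §II]
* D. P. Bertsekas, *Nonlinear Programming*, 2nd ed. (1999), Prop. 5.1.3 (nonnegative combinations of valid inequalities).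
  [cite: Bertsekas1999NonlinearProgramming, Prop. 5.1.3]
* D. J. Scalapino, S. R. White, S.-C. Zhang, Phys. Rev. B 47 (1993) 7995, §II (the f-sum bound on the superfluid weight that §2 serves).
  [cite: ScalapinoWhiteZhang1993, §II]
-/

noncomputable section

namespace Literature.MathematicalPhysics.QuantumLattice

open Matrix Finset HubbardWave0 Literature.Probability.LatticeModels ThermodynamicLimit
open _root_.Filter
open scoped _root_.Topology ComplexOrder BigOperators

namespace InfVolFermionState

/-! ### §1 The apex row, every pair of states -/

/-- **Apex row, every pair of states.** Let `ωP, ωA` be two states and `A = (t, t'_A, U_A)`, `P = (t, t'_P, U_P)` two couplings with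
`0 ≤ U_A`, `0 ≤ U_P` and the two cross inequalities `e_{Φ(P)}(ωP) ≤ e_{Φ(P)}(ωA)`, `e_{Φ(A)}(ωA) ≤ e_{Φ(A)}(ωP)`. Then
`(U_P − U_A)·t·K₁(ωA) + (U_P t'_A − U_A t'_P)·K₂(ωA) ≤ (U_P − U_A)·t·K₁(ωP) + (U_P t'_A − U_A t'_P)·K₂(ωP)`: the combination
`U_P·(second) + U_A·(first)` of the two inequalities, in which the on-site coordinate `D` cancels. [cite: KomaTasaki1994, §1] [cite: Griffiths1966, §II] -/
theorem apex_le_of_cross_variational (ωP ωA : InfVolFermionState 2) {t t'A UA t'P UP : ℝ} (hUA : 0 ≤ UA)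
    (hUP : 0 ≤ UP)
    (hP : ωP.meanEnergy (hubbardTTPrimeFermionInteraction t t'P UP) 1 ≤
      ωA.meanEnergy (hubbardTTPrimeFermionInteraction t t'P UP) 1)
    (hA : ωA.meanEnergy (hubbardTTPrimeFermionInteraction t t'A UA) 1 ≤
      ωP.meanEnergy (hubbardTTPrimeFermionInteraction t t'A UA) 1) :
    (UP - UA) * t * ωA.meanEnergy (hubbardTTPrimeFermionInteraction 1 0 0) 1 +
        (UP * t'A - UA * t'P) * ωA.meanEnergy (hubbardTTPrimeFermionInteraction 0 1 0) 1 ≤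
      (UP - UA) * t * ωP.meanEnergy (hubbardTTPrimeFermionInteraction 1 0 0) 1 +
        (UP * t'A - UA * t'P) * ωP.meanEnergy (hubbardTTPrimeFermionInteraction 0 1 0) 1 := by
  rw [ωP.meanEnergy_hubbardTTPrime_eq_coords t t'P UP, ωA.meanEnergy_hubbardTTPrime_eq_coords t t'P UP] at hP
  rw [ωA.meanEnergy_hubbardTTPrime_eq_coords t t'A UA, ωP.meanEnergy_hubbardTTPrime_eq_coords t t'A UA] at hA
  have h1 := mul_le_mul_of_nonneg_left hA hUP
  have h2 := mul_le_mul_of_nonneg_left hP hUA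
  nlinarith [h1, h2]

/-- **Apex row in mean-energy form**: under the hypotheses of `apex_le_of_cross_variational`,
`e_{Φ((U_P−U_A)t, U_P t'_A − U_A t'_P, 0)}(ωA) ≤ e_{Φ((U_P−U_A)t, U_P t'_A − U_A t'_P, 0)}(ωP)`. [cite: KomaTasaki1994, §1] -/
theorem meanEnergy_apex_le_of_cross_variational (ωP ωA : InfVolFermionState 2) {t t'A UA t'P UP : ℝ} (hUA : 0 ≤ UA)
    (hUP : 0 ≤ UP)
    (hP : ωP.meanEnergy (hubbardTTPrimeFermionInteraction t t'P UP) 1 ≤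
      ωA.meanEnergy (hubbardTTPrimeFermionInteraction t t'P UP) 1)
    (hA : ωA.meanEnergy (hubbardTTPrimeFermionInteraction t t'A UA) 1 ≤
      ωP.meanEnergy (hubbardTTPrimeFermionInteraction t t'A UA) 1) :
    ωA.meanEnergy (hubbardTTPrimeFermionInteraction ((UP - UA) * t) (UP * t'A - UA * t'P) 0) 1 ≤
      ωP.meanEnergy (hubbardTTPrimeFermionInteraction ((UP - UA) * t) (UP * t'A - UA * t'P) 0) 1 := by
  rw [ωA.meanEnergy_hubbardTTPrime_eq_coords, ωP.meanEnergy_hubbardTTPrime_eq_coords, zero_mul, zero_mul, add_zero,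
    add_zero, mul_assoc, mul_assoc]
  have h := apex_le_of_cross_variational ωP ωA hUA hUP hP hA
  simpa only [mul_assoc] using h

/-- **The one-body energy at the APEX HOPPING is non-decreasing from `A` to `P`** (`0 ≤ U_A < U_P`): under the two cross
inequalities, `e_{Φ(t,κ,0)}(ωA) ≤ e_{Φ(t,κ,0)}(ωP)` with `κ = (U_P t'_A − U_A t'_P)/(U_P − U_A)` — the `t'`-coordinate where the
line through `(t'_A, U_A)` and `(t'_P, U_P)` meets `U = 0`. The vertical case `t'_A = t'_P` (`κ = t'`) is T-mono
(`docc_le_and_oneBody_le_of_cross_variational`). [cite: KomaTasaki1994, §1] [cite: Griffiths1966, §II] -/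
theorem meanEnergy_apexHopping_le_of_cross_variational (ωP ωA : InfVolFermionState 2) {t t'A UA t'P UP : ℝ}
    (hUA : 0 ≤ UA) (hU : UA < UP)
    (hP : ωP.meanEnergy (hubbardTTPrimeFermionInteraction t t'P UP) 1 ≤
      ωA.meanEnergy (hubbardTTPrimeFermionInteraction t t'P UP) 1)
    (hA : ωA.meanEnergy (hubbardTTPrimeFermionInteraction t t'A UA) 1 ≤
      ωP.meanEnergy (hubbardTTPrimeFermionInteraction t t'A UA) 1) :
    ωA.meanEnergy (hubbardTTPrimeFermionInteraction t ((UP * t'A - UA * t'P) / (UP - UA)) 0) 1 ≤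
      ωP.meanEnergy (hubbardTTPrimeFermionInteraction t ((UP * t'A - UA * t'P) / (UP - UA)) 0) 1 := by
  have hd : 0 < UP - UA := sub_pos.2 hU
  have e1 : (UP - UA)⁻¹ * ((UP - UA) * t) = t := by rw [← mul_assoc, inv_mul_cancel₀ hd.ne', one_mul]
  have e2 : (UP - UA)⁻¹ * (UP * t'A - UA * t'P) = (UP * t'A - UA * t'P) / (UP - UA) := by
    rw [inv_mul_eq_div]
  have hsA := ωA.meanEnergy_hubbardTTPrime_smul (UP - UA)⁻¹ ((UP - UA) * t) (UP * t'A - UA * t'P) 0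
  have hsP := ωP.meanEnergy_hubbardTTPrime_smul (UP - UA)⁻¹ ((UP - UA) * t) (UP * t'A - UA * t'P) 0
  rw [e1, e2, mul_zero] at hsA hsP
  rw [hsA, hsP]
  exact mul_le_mul_of_nonneg_left
    (meanEnergy_apex_le_of_cross_variational ωP ωA hUA (hUA.trans hU.le) hP hA) (inv_pos.2 hd).le

/-! ### §2 The doubled-hopping case: `A` on the segment from the apex `(2t'_P, 0)` to `P` -/

/-- **Doubled-hopping apex row, every pair of states.** If `0 ≤ U_A < U_P` and `A` lies on the segment from the apex
`X_P = (2t'_P, 0)` to `P = (t'_P, U_P)`, i.e. `U_P·t'_A = (2U_P − U_A)·t'_P`, then the apex hopping is `2t'_P` and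
`e_{Φ(t,2t'_P,0)}(ωA) ≤ e_{Φ(t,2t'_P,0)}(ωP)` under the two cross inequalities: the one-body energy at DOUBLED `t'_P` — minus four
times the `D₄`-mean `t–t'` f-sum stiffness functional at `P` — is non-decreasing from `A` to `P`. [cite: KomaTasaki1994, §1] [cite: ScalapinoWhiteZhang1993, §II] -/
theorem meanEnergy_twice_tPrime_le_of_cross_variational_of_apex (ωP ωA : InfVolFermionState 2) {t t'A UA t'P UP : ℝ}
    (hUA : 0 ≤ UA) (hU : UA < UP) (hapex : UP * t'A = (2 * UP - UA) * t'P)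
    (hP : ωP.meanEnergy (hubbardTTPrimeFermionInteraction t t'P UP) 1 ≤
      ωA.meanEnergy (hubbardTTPrimeFermionInteraction t t'P UP) 1)
    (hA : ωA.meanEnergy (hubbardTTPrimeFermionInteraction t t'A UA) 1 ≤
      ωP.meanEnergy (hubbardTTPrimeFermionInteraction t t'A UA) 1) :
    ωA.meanEnergy (hubbardTTPrimeFermionInteraction t (2 * t'P) 0) 1 ≤
      ωP.meanEnergy (hubbardTTPrimeFermionInteraction t (2 * t'P) 0) 1 := by
  have hd : 0 < UP - UA := sub_pos.2 hU
  have e : (UP * t'A - UA * t'P) / (UP - UA) = 2 * t'P := by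
    rw [div_eq_iff hd.ne', hapex]
    ring
  have h := meanEnergy_apexHopping_le_of_cross_variational ωP ωA hUA hU hP hA
  rwa [e] at h

/-! ### §3 Torus-limit ground states -/

/-- **The two cross variational inequalities of a pair of torus-limit ground states.** If `ωA`, `ωP` are torus limits of unit
`(rectN n, S^z = 0)`-sector ground states at `A = (t_A, t'_A, U_A)` and `P = (t_P, t'_P, U_P)` (`U_A, U_P ≥ 0`, same density
`0 ≤ n < 2`), then `e_{Φ(P)}(ωP) ≤ e_{Φ(P)}(ωA)` and `e_{Φ(A)}(ωA) ≤ e_{Φ(A)}(ωP)`: each state realises the ground-state energy density at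
its own coupling (`meanEnergy_hubbardTTPrime_eq_energyDensityTT'`), which the other cannot undercut
(`energyDensityTT'_le_meanEnergy_hubbardTTPrime`). [cite: KomaTasaki1994, §1] -/
theorem IsTorusLimitOf.cross_variational_of_groundStates (tA t'A tP t'P : ℝ) {UA UP : ℝ} (hUA : 0 ≤ UA) (hUP : 0 ≤ UP)
    {n : ℝ} (hn0 : 0 ≤ n) (hn2 : n < 2)
    {ωA ωP : InfVolFermionState 2} {ψA ψP : ∀ L, Fock (Orb (FermionTorus 2 L))} {LsA LsP : ℕ → ℕ}
    (hA : ωA.IsTorusLimitOf ψA LsA) (hLsA : Tendsto LsA atTop atTop)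
    (hψA : ∀ j, IsGroundStateInSector (hubbardTorusTT' (LsA j) tA t'A UA) (rectN n (LsA j)) 0 (ψA (LsA j)))
    (h1A : ∀ j, star (ψA (LsA j)) ⬝ᵥ ψA (LsA j) = 1)
    (hP : ωP.IsTorusLimitOf ψP LsP) (hLsP : Tendsto LsP atTop atTop)
    (hψP : ∀ j, IsGroundStateInSector (hubbardTorusTT' (LsP j) tP t'P UP) (rectN n (LsP j)) 0 (ψP (LsP j)))
    (h1P : ∀ j, star (ψP (LsP j)) ⬝ᵥ ψP (LsP j) = 1) :
    ωP.meanEnergy (hubbardTTPrimeFermionInteraction tP t'P UP) 1 ≤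
        ωA.meanEnergy (hubbardTTPrimeFermionInteraction tP t'P UP) 1 ∧
      ωA.meanEnergy (hubbardTTPrimeFermionInteraction tA t'A UA) 1 ≤
        ωP.meanEnergy (hubbardTTPrimeFermionInteraction tA t'A UA) 1 := by
  have hNA : ∀ j, IsNParticle (rectN n (LsA j)) (ψA (LsA j)) := fun j =>
    ((mem_szSector_iff _ _ _).1 (hψA j).1).1
  have hNP : ∀ j, IsNParticle (rectN n (LsP j)) (ψP (LsP j)) := fun j =>
    ((mem_szSector_iff _ _ _).1 (hψP j).1).1
  refine ⟨?_, ?_⟩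
  · rw [hP.meanEnergy_hubbardTTPrime_eq_energyDensityTT' tP t'P hUP hn0 hn2 hLsP hψP h1P]
    exact hA.energyDensityTT'_le_meanEnergy_hubbardTTPrime tP t'P hUP hn0 hn2 hLsA hNA h1A
  · rw [hA.meanEnergy_hubbardTTPrime_eq_energyDensityTT' tA t'A hUA hn0 hn2 hLsA hψA h1A]
    exact hP.energyDensityTT'_le_meanEnergy_hubbardTTPrime tA t'A hUA hn0 hn2 hLsP hNP h1P

/-- **Apex row for torus-limit ground states**: two torus limits of unit sector ground states of the same density at
`(t, t'_A, U_A)` and `(t, t'_P, U_P)` (`U_A, U_P ≥ 0`) satisfy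
`(U_P − U_A)·t·K₁(ωA) + (U_P t'_A − U_A t'_P)·K₂(ωA) ≤ (U_P − U_A)·t·K₁(ωP) + (U_P t'_A − U_A t'_P)·K₂(ωP)`. [cite: KomaTasaki1994, §1] [cite: Griffiths1966, §II] -/
theorem IsTorusLimitOf.apex_le_of_groundStates (t t'A t'P : ℝ) {UA UP : ℝ} (hUA : 0 ≤ UA) (hUP : 0 ≤ UP)
    {n : ℝ} (hn0 : 0 ≤ n) (hn2 : n < 2)
    {ωA ωP : InfVolFermionState 2} {ψA ψP : ∀ L, Fock (Orb (FermionTorus 2 L))} {LsA LsP : ℕ → ℕ}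
    (hA : ωA.IsTorusLimitOf ψA LsA) (hLsA : Tendsto LsA atTop atTop)
    (hψA : ∀ j, IsGroundStateInSector (hubbardTorusTT' (LsA j) t t'A UA) (rectN n (LsA j)) 0 (ψA (LsA j)))
    (h1A : ∀ j, star (ψA (LsA j)) ⬝ᵥ ψA (LsA j) = 1)
    (hP : ωP.IsTorusLimitOf ψP LsP) (hLsP : Tendsto LsP atTop atTop)
    (hψP : ∀ j, IsGroundStateInSector (hubbardTorusTT' (LsP j) t t'P UP) (rectN n (LsP j)) 0 (ψP (LsP j)))
    (h1P : ∀ j, star (ψP (LsP j)) ⬝ᵥ ψP (LsP j) = 1) :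
    (UP - UA) * t * ωA.meanEnergy (hubbardTTPrimeFermionInteraction 1 0 0) 1 +
        (UP * t'A - UA * t'P) * ωA.meanEnergy (hubbardTTPrimeFermionInteraction 0 1 0) 1 ≤
      (UP - UA) * t * ωP.meanEnergy (hubbardTTPrimeFermionInteraction 1 0 0) 1 +
        (UP * t'A - UA * t'P) * ωP.meanEnergy (hubbardTTPrimeFermionInteraction 0 1 0) 1 := by
  obtain ⟨hcP, hcA⟩ := IsTorusLimitOf.cross_variational_of_groundStates t t'A t t'P hUA hUP hn0 hn2 hA hLsA hψA h1A
    hP hLsP hψP h1P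
  exact apex_le_of_cross_variational ωP ωA hUA hUP hcP hcA

/-- **One-body energy at the apex hopping, torus-limit ground states** (`0 ≤ U_A < U_P`, same density):
`e_{Φ(t,κ,0)}(ωA) ≤ e_{Φ(t,κ,0)}(ωP)`, `κ = (U_P t'_A − U_A t'_P)/(U_P − U_A)` — a certified CEILING on `−e_{Φ(t,κ,0)}` at `A` holds at
`P`, a FLOOR at `P` holds at `A`. [cite: KomaTasaki1994, §1] [cite: Griffiths1966, §II] -/
theorem IsTorusLimitOf.meanEnergy_apexHopping_le_of_groundStates (t t'A t'P : ℝ) {UA UP : ℝ} (hUA : 0 ≤ UA)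
    (hU : UA < UP) {n : ℝ} (hn0 : 0 ≤ n) (hn2 : n < 2)
    {ωA ωP : InfVolFermionState 2} {ψA ψP : ∀ L, Fock (Orb (FermionTorus 2 L))} {LsA LsP : ℕ → ℕ}
    (hA : ωA.IsTorusLimitOf ψA LsA) (hLsA : Tendsto LsA atTop atTop)
    (hψA : ∀ j, IsGroundStateInSector (hubbardTorusTT' (LsA j) t t'A UA) (rectN n (LsA j)) 0 (ψA (LsA j)))
    (h1A : ∀ j, star (ψA (LsA j)) ⬝ᵥ ψA (LsA j) = 1)
    (hP : ωP.IsTorusLimitOf ψP LsP) (hLsP : Tendsto LsP atTop atTop)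
    (hψP : ∀ j, IsGroundStateInSector (hubbardTorusTT' (LsP j) t t'P UP) (rectN n (LsP j)) 0 (ψP (LsP j)))
    (h1P : ∀ j, star (ψP (LsP j)) ⬝ᵥ ψP (LsP j) = 1) :
    ωA.meanEnergy (hubbardTTPrimeFermionInteraction t ((UP * t'A - UA * t'P) / (UP - UA)) 0) 1 ≤
      ωP.meanEnergy (hubbardTTPrimeFermionInteraction t ((UP * t'A - UA * t'P) / (UP - UA)) 0) 1 := by
  obtain ⟨hcP, hcA⟩ := IsTorusLimitOf.cross_variational_of_groundStates t t'A t t'P hUA (hUA.trans hU.le) hn0 hn2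
    hA hLsA hψA h1A hP hLsP hψP h1P
  exact meanEnergy_apexHopping_le_of_cross_variational ωP ωA hUA hU hcP hcA

/-- **Doubled-hopping apex row for torus-limit ground states.** `0 ≤ U_A < U_P`, `U_P·t'_A = (2U_P − U_A)·t'_P` (the source `A`
lies on the segment from the apex `(2t'_P, 0)` to the target `P`), same density `0 ≤ n < 2`: `e_{Φ(t,2t'_P,0)}(ωA) ≤ e_{Φ(t,2t'_P,0)}(ωP)`.
With the f-sum dictionary: the `t–t'` f-sum stiffness ceiling of the class at `P` (`= −¼e_{Φ(1,2t'_P,0)}` on it) is at most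
`−¼e_{Φ(1,2t'_P,0)}(ωA)` for ANY torus-limit ground state `ωA` of the source class — the `U`-interior transport rule at `t' ≠ 0`.
[cite: KomaTasaki1994, §1] [cite: ScalapinoWhiteZhang1993, §II] -/
theorem IsTorusLimitOf.meanEnergy_twice_tPrime_le_of_groundStates_apex (t t'A t'P : ℝ) {UA UP : ℝ} (hUA : 0 ≤ UA)
    (hU : UA < UP) (hapex : UP * t'A = (2 * UP - UA) * t'P) {n : ℝ} (hn0 : 0 ≤ n) (hn2 : n < 2)
    {ωA ωP : InfVolFermionState 2} {ψA ψP : ∀ L, Fock (Orb (FermionTorus 2 L))} {LsA LsP : ℕ → ℕ}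
    (hA : ωA.IsTorusLimitOf ψA LsA) (hLsA : Tendsto LsA atTop atTop)
    (hψA : ∀ j, IsGroundStateInSector (hubbardTorusTT' (LsA j) t t'A UA) (rectN n (LsA j)) 0 (ψA (LsA j)))
    (h1A : ∀ j, star (ψA (LsA j)) ⬝ᵥ ψA (LsA j) = 1)
    (hP : ωP.IsTorusLimitOf ψP LsP) (hLsP : Tendsto LsP atTop atTop)
    (hψP : ∀ j, IsGroundStateInSector (hubbardTorusTT' (LsP j) t t'P UP) (rectN n (LsP j)) 0 (ψP (LsP j)))
    (h1P : ∀ j, star (ψP (LsP j)) ⬝ᵥ ψP (LsP j) = 1) :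
    ωA.meanEnergy (hubbardTTPrimeFermionInteraction t (2 * t'P) 0) 1 ≤
      ωP.meanEnergy (hubbardTTPrimeFermionInteraction t (2 * t'P) 0) 1 := by
  obtain ⟨hcP, hcA⟩ := IsTorusLimitOf.cross_variational_of_groundStates t t'A t t'P hUA (hUA.trans hU.le) hn0 hn2
    hA hLsA hψA h1A hP hLsP hψP h1P
  exact meanEnergy_twice_tPrime_le_of_cross_variational_of_apex ωP ωA hUA hU hapex hcP hcA

/-! ### §4 Half filling: the diagonal-hopping energy has the sign of `−t'`, and the source's own word compares -/

/-- **`t'·K₂(ω) ≤ 0` for every torus-limit ground state at half filling.** `U ≥ 0`; `ω` a torus limit of unit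
`(rectN 1, S^z = 0)`-sector ground states of `hubbardTorusTT' L t t' U`. The energy density at `n = 1` is even in `t'`
(`energyDensityTT'_particleHole_one`), so the variational inequality at the mirror coupling reads
`e(t,t',U,1) = e(t,−t',U,1) ≤ e_{Φ(t,−t',U)}(ω) = e(t,t',U,1) − 2t'·K₂(ω)`. [cite: KomaTasaki1994, §1] [cite: LiebWuPhysicaA2003, §1 eq. (3)] -/
theorem IsTorusLimitOf.tPrime_mul_diagHopEnergy_nonpos_of_groundState_halfFilling (t t' : ℝ) {U : ℝ} (hU : 0 ≤ U)
    {ω : InfVolFermionState 2} {ψ : ∀ L, Fock (Orb (FermionTorus 2 L))} {Ls : ℕ → ℕ}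
    (hω : ω.IsTorusLimitOf ψ Ls) (hLs : Tendsto Ls atTop atTop)
    (hψ : ∀ j, IsGroundStateInSector (hubbardTorusTT' (Ls j) t t' U) (rectN 1 (Ls j)) 0 (ψ (Ls j)))
    (h1 : ∀ j, star (ψ (Ls j)) ⬝ᵥ ψ (Ls j) = 1) :
    t' * ω.meanEnergy (hubbardTTPrimeFermionInteraction 0 1 0) 1 ≤ 0 := by
  have hN : ∀ j, IsNParticle (rectN 1 (Ls j)) (ψ (Ls j)) := fun j => ((mem_szSector_iff _ _ _).1 (hψ j).1).1
  have hown := hω.meanEnergy_hubbardTTPrime_eq_energyDensityTT' t t' hU zero_le_one one_lt_two hLs hψ h1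
  have hvar := hω.energyDensityTT'_le_meanEnergy_hubbardTTPrime t (-t') hU zero_le_one one_lt_two hLs hN h1
  rw [energyDensityTT'_particleHole_one t t' hU, ω.meanEnergy_hubbardTTPrime_affine t t' U (-t') U, hown, sub_self,
    zero_mul, add_zero] at hvar
  nlinarith [hvar]

/-- **At half filling the one-body energy is monotone in the hopping in the direction of `t'`.** For a torus-limit ground state
`ω` at `(t, t', U, 1)` (`U ≥ 0`) and two hoppings with `κ' − κ = c·t'`, `c ≥ 0`: `e_{Φ(t,κ',0)}(ω) ≤ e_{Φ(t,κ,0)}(ω)` (the difference is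
`c·t'·K₂(ω) ≤ 0`). So a certified CEILING on `−e_{Φ(t,κ',0)}(ω)` (e.g. the class's own f-sum word, `κ' = 2t'`) is a ceiling on
`−e_{Φ(t,κ,0)}(ω)` for every `κ` between `κ'` and `κ' − c t'`. [cite: KomaTasaki1994, §1] -/
theorem IsTorusLimitOf.meanEnergy_oneBody_anti_hopping_of_groundState_halfFilling (t t' : ℝ) {U : ℝ} (hU : 0 ≤ U)
    {ω : InfVolFermionState 2} {ψ : ∀ L, Fock (Orb (FermionTorus 2 L))} {Ls : ℕ → ℕ}
    (hω : ω.IsTorusLimitOf ψ Ls) (hLs : Tendsto Ls atTop atTop)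
    (hψ : ∀ j, IsGroundStateInSector (hubbardTorusTT' (Ls j) t t' U) (rectN 1 (Ls j)) 0 (ψ (Ls j)))
    (h1 : ∀ j, star (ψ (Ls j)) ⬝ᵥ ψ (Ls j) = 1) {κ κ' c : ℝ} (hc : 0 ≤ c) (hκ : κ' - κ = c * t') :
    ω.meanEnergy (hubbardTTPrimeFermionInteraction t κ' 0) 1 ≤
      ω.meanEnergy (hubbardTTPrimeFermionInteraction t κ 0) 1 := by
  have hs := IsTorusLimitOf.tPrime_mul_diagHopEnergy_nonpos_of_groundState_halfFilling t t' hU hω hLs hψ h1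
  rw [ω.meanEnergy_hubbardTTPrime_affine t κ 0 κ' 0, sub_self, zero_mul, add_zero, hκ]
  nlinarith [mul_nonpos_iff.2 (Or.inl ⟨hc, hs⟩)]

/-- **At half filling the SOURCE's own f-sum word bounds the target's.** `0 ≤ U_A < U_P`, `U_P·t'_A = (2U_P − U_A)·t'_P`, density `1`,
ANY sign of `t'`: for torus-limit ground states `ωA` at `(t, t'_A, U_A, 1)` and `ωP` at `(t, t'_P, U_P, 1)`,
`e_{Φ(t,2t'_A,0)}(ωA) ≤ e_{Φ(t,2t'_P,0)}(ωP)` — by §4 at the source (`2t'_A − 2t'_P = c·t'_A` with `c = 2(U_P − U_A)/(2U_P − U_A) ≥ 0`)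
and the doubled-hopping apex row. Reading: the `D₄`-mean `t–t'` f-sum stiffness ceiling at `P` is at most the one at `A`.
[cite: KomaTasaki1994, §1] [cite: ScalapinoWhiteZhang1993, §II] -/
theorem IsTorusLimitOf.meanEnergy_twice_tPrime_source_le_of_groundStates_apex_halfFilling (t t'A t'P : ℝ) {UA UP : ℝ}
    (hUA : 0 ≤ UA) (hU : UA < UP) (hapex : UP * t'A = (2 * UP - UA) * t'P)
    {ωA ωP : InfVolFermionState 2} {ψA ψP : ∀ L, Fock (Orb (FermionTorus 2 L))} {LsA LsP : ℕ → ℕ}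
    (hA : ωA.IsTorusLimitOf ψA LsA) (hLsA : Tendsto LsA atTop atTop)
    (hψA : ∀ j, IsGroundStateInSector (hubbardTorusTT' (LsA j) t t'A UA) (rectN 1 (LsA j)) 0 (ψA (LsA j)))
    (h1A : ∀ j, star (ψA (LsA j)) ⬝ᵥ ψA (LsA j) = 1)
    (hP : ωP.IsTorusLimitOf ψP LsP) (hLsP : Tendsto LsP atTop atTop)
    (hψP : ∀ j, IsGroundStateInSector (hubbardTorusTT' (LsP j) t t'P UP) (rectN 1 (LsP j)) 0 (ψP (LsP j)))
    (h1P : ∀ j, star (ψP (LsP j)) ⬝ᵥ ψP (LsP j) = 1) :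
    ωA.meanEnergy (hubbardTTPrimeFermionInteraction t (2 * t'A) 0) 1 ≤
      ωP.meanEnergy (hubbardTTPrimeFermionInteraction t (2 * t'P) 0) 1 := by
  have h2 : 0 < 2 * UP - UA := by linarith
  have hc : 0 ≤ 2 * (UP - UA) / (2 * UP - UA) := div_nonneg (by linarith) h2.le
  have hκ : 2 * t'A - 2 * t'P = 2 * (UP - UA) / (2 * UP - UA) * t'A := by
    have ht'P : t'P = UP * t'A / (2 * UP - UA) := by rw [eq_div_iff h2.ne', hapex]; ring
    rw [ht'P]
    field_simp
    ring
  exact (IsTorusLimitOf.meanEnergy_oneBody_anti_hopping_of_groundState_halfFilling t t'A hUA hA hLsA hψA h1A hc hκ).trans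
    (IsTorusLimitOf.meanEnergy_twice_tPrime_le_of_groundStates_apex t t'A t'P hUA hU hapex zero_le_one one_lt_two hA hLsA
      hψA h1A hP hLsP hψP h1P)

end InfVolFermionState

end Literature.MathematicalPhysics.QuantumLattice

end
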